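import Literature.AlgebraicGeometry.Motives.EtaleToProetDensityProofs
import HarnessLib

/-!
# Presented covers of a pro-étale affine (Bhatt–Scholze, proof of Cor. 5.1.6): the structure

A pro-étale affine `W ∈ X_proét^aff` is presented as `W = lim_i U_i` by a small cofiltered diagram of
affine schemes in `X_ét` (`ProetAffinePresentation`, Bhatt–Scholze Def. 4.2.1). In the proof of
Cor. 5.1.6, `Hᵖ(W, ν*I) = 0` is computed on "a cofinal collection of covers of `U` in `X_proét` …
obtained by taking cofiltered limits of affine étale covers obtained via base change from some
`U_i`" (Thm. 2.3.4). This file fixes the data of such a **presented cover** of `W` relative to a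
presentation `𝔭`:

* `PresentedCover 𝔭` — finitely many pieces `V_a = lim_k V_{a,k}` (`a : Fin r`) presented over a
  common small cofiltered `K` with an initial `p : K → ι`, by affine `V_{a,k} ∈ X_ét` with compatible
  maps `V_{a,k} → U_{p k}`, together with the induced `V_a → W`, required to generate a pro-étale
  covering sieve jointly (finite families, because covering sieves are not closed under finite
  coproducts);
* clean-typed accessors (`τ'`, `ρ'`, `isLimit_fac/uniq`; `ProetAffinePresentation.proj` is the
  tree's, `EtaleToProetDensityProofs.lean`), the
  presentation `toPresentation a` of each piece, and the covering family `family` as a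
  pre-`0`-hypercover indexed in `Type (u+1)`;
* `isAffine_widePullback_left` — finite wide pullbacks of affine objects of `X_ét` are affine
  (Mathlib `Scheme.isAffine_of_isLimit`; for the fibre products of the pieces in
  `EtaleToProetCechCover.lean`).

The Čech computation on presented covers is `EtaleToProetCechCover.lean`; presented covers are
produced from finitely many pro-étale affines over `W` in `EtaleToProetPieces.lean`.

## References

* B. Bhatt, P. Scholze, *The pro-étale topology for schemes*, Astérisque 369 (2015)
  (arXiv:1309.1198, held): Def. 4.2.1, Remark 4.2.3, Cor. 5.1.6 (proof, p. 30), Thm. 2.3.4.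
  [BhattScholze2015]

## Design notes

* Real definitions and theorems only (D-0026); the covering property is the field `mem`.
* `family` is reducible (so that `c.family.I₀ = ULift (Fin r)`, `c.family.f a = c.hom a.down`
  unfold under rewriting).
* Mathlib searched: `Scheme.isAffine_of_isLimit` (used: limits of affine schemes over any index
  category are affine); no presentations of covers of pro-objects. Nothing restated.
-/

universe uS

open CategoryTheory Limits Opposite AlgebraicGeometry

noncomputable section

namespace Literature.AlgebraicGeometry.Motives

/-! ### Finite wide pullbacks of affine schemes are affine -/

variable {X : Scheme.{uS}}

/-- The underlying scheme of a finite wide pullback of affine objects of `X_ét` over an affine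
object is affine (the forgetful functor `X_ét → Sch` preserves connected finite limits, and a limit
of affine schemes is affine, Mathlib `Scheme.isAffine_of_isLimit`). [folklore] -/
theorem isAffine_widePullback_left {n : ℕ} (B : X.Etale) (objs : Fin (n + 1) → X.Etale)
    (arrows : ∀ a, objs a ⟶ B) [IsAffine B.left] [∀ a, IsAffine (objs a).left] :
    IsAffine (widePullback B objs arrows).left := by
  let G := Scheme.Etale.forget X ⋙ Over.forget X
  haveI : PreservesLimitsOfShape (WidePullbackShape (Fin (n + 1))) G :=
    comp_preservesLimitsOfShape _ _
  haveI : ∀ j, IsAffine ((WidePullbackShape.wideCospan B objs arrows ⋙ G).obj j) := fun j =>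
    match j with
    | none => inferInstanceAs (IsAffine B.left)
    | some a => inferInstanceAs (IsAffine (objs a).left)
  exact Scheme.isAffine_of_isLimit _
    (isLimitOfPreserves G (limit.isLimit (WidePullbackShape.wideCospan B objs arrows)))

/-! ### Presented covers of a presented pro-étale affine (Bhatt–Scholze, proof of Cor. 5.1.6) -/

section PresentedCover

variable {W : X.ProEt} (𝔭 : ProetAffinePresentation X W)

/-- **A presented cover** of a pro-étale affine `W = lim_i U_i` (Bhatt–Scholze, proof of
Cor. 5.1.6: "a cofinal collection of covers of `U` in `X_proét` is obtained by taking cofiltered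
limits of affine étale covers obtained via base change from some `U_i`"): a small cofiltered `K`
with an initial functor `p : K → ι`, finitely many pieces `a`, affine schemes `V_{a,k} ∈ X_ét`
with compatible maps `V_{a,k} → U_{p k}`, their limits `V_a = lim_k V_{a,k}` (as `X`-schemes), and
the induced morphisms `V_a → W`, required to generate a pro-étale covering sieve jointly. (The maps
`V_{a,k} → U_{p k}` need not be covers: only the family `(V_a → W)_a` is; finitely many pieces are
needed because covering sieves are not closed under finite coproducts.)
[cite: BhattScholze2015, Cor. 5.1.6 (proof)] -/
structure PresentedCover where
  /-- the small cofiltered index category of the cover -/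
  K : Type uS
  [smallCategory : SmallCategory K]
  [isCofiltered : IsCofiltered K]
  /-- the comparison of index categories -/
  p : K ⥤ 𝔭.ι
  [initial : p.Initial]
  /-- the number of pieces of the cover -/
  r : ℕ
  /-- the diagrams `k ↦ V_{a,k}` of affine schemes in `X_ét`, one for each piece `a` -/
  diagram (a : Fin r) : K ⥤ X.Etale
  /-- each `V_{a,k}` is affine -/
  isAffine (a : Fin r) (k : K) : IsAffine ((diagram a).obj k).left
  /-- the maps `V_{a,k} → U_{p k}` -/
  τ (a : Fin r) : diagram a ⟶ p ⋙ 𝔭.diagram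
  /-- the pieces `V_a` of the cover -/
  V (a : Fin r) : X.ProEt
  /-- the projections `V_a → V_{a,k}` -/
  ρ (a : Fin r) : (Functor.const K).obj (V a) ⟶ diagram a ⋙ etaleToProet X
  /-- `V_a = lim_k V_{a,k}` as `X`-schemes -/
  isLimit (a : Fin r) : IsLimit ((Scheme.ProEt.forget X).mapCone (Cone.mk (V a) (ρ a)))
  /-- the covering morphisms `V_a → W` -/
  hom (a : Fin r) : V a ⟶ W
  /-- compatibility of `V_a → W` with the levelwise maps -/
  comm (a : Fin r) (k : K) : (ρ a).app k ≫ (etaleToProet X).map ((τ a).app k) = hom a ≫ 𝔭.π.app (p.obj k)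
  /-- the `V_a → W` generate a covering sieve of the pro-étale topology -/
  mem : Sieve.generate (Presieve.ofArrows (fun a : ULift.{uS + 1} (Fin r) => V a.down)
    (fun a => hom a.down)) ∈ Scheme.ProEt.topology X W

namespace PresentedCover

variable {𝔭} (c : PresentedCover 𝔭)

attribute [instance] PresentedCover.smallCategory PresentedCover.isCofiltered PresentedCover.initial

/-- `V_{a,k} → U_{p k}` (the component of `c.τ a`, with its type spelled out). [folklore] -/
def τ' (a : Fin c.r) (k : c.K) : (c.diagram a).obj k ⟶ 𝔭.diagram.obj (c.p.obj k) := (c.τ a).app k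

/-- Naturality of `τ'`. [folklore] -/
@[reassoc]
lemma τ'_naturality (a : Fin c.r) {k k' : c.K} (g : k ⟶ k') :
    (c.diagram a).map g ≫ c.τ' a k' = c.τ' a k ≫ 𝔭.diagram.map (c.p.map g) :=
  (c.τ a).naturality g

/-- `V_a → V_{a,k}` (the component of `c.ρ a`, with its type spelled out). [folklore] -/
def ρ' (a : Fin c.r) (k : c.K) : c.V a ⟶ (etaleToProet X).obj ((c.diagram a).obj k) := (c.ρ a).app k

/-- The projections `V_a → V_{a,k}` are compatible with the transition maps. [folklore] -/
@[reassoc]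
lemma ρ'_comp (a : Fin c.r) {k k' : c.K} (g : k ⟶ k') :
    c.ρ' a k ≫ (etaleToProet X).map ((c.diagram a).map g) = c.ρ' a k' :=
  (((c.ρ a).naturality g).symm.trans (Category.id_comp _))

/-- `V_a → V_{a,k} → U_{p k}` is `V_a → W → U_{p k}`. [folklore] -/
@[reassoc]
lemma ρ'_τ' (a : Fin c.r) (k : c.K) :
    c.ρ' a k ≫ (etaleToProet X).map (c.τ' a k) = c.hom a ≫ 𝔭.proj (c.p.obj k) :=
  c.comm a k

/-- The universal property of `V_a = lim_k V_{a,k}`: factorisation. [folklore] -/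
lemma isLimit_fac (a : Fin c.r) (s : Cone ((c.diagram a ⋙ etaleToProet X) ⋙ Scheme.ProEt.forget X))
    (k : c.K) : (c.isLimit a).lift s ≫ (Scheme.ProEt.forget X).map (c.ρ' a k) = s.π.app k :=
  (c.isLimit a).fac s k

/-- The universal property of `V_a = lim_k V_{a,k}`: uniqueness. [folklore] -/
lemma isLimit_uniq (a : Fin c.r) (s : Cone ((c.diagram a ⋙ etaleToProet X) ⋙ Scheme.ProEt.forget X))
    (m : s.pt ⟶ (Scheme.ProEt.forget X).obj (c.V a))
    (hm : ∀ k, m ≫ (Scheme.ProEt.forget X).map (c.ρ' a k) = s.π.app k) : m = (c.isLimit a).lift s :=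
  (c.isLimit a).uniq s m hm

/-- Each piece of a presented cover is presented by its own diagram.
[cite: BhattScholze2015, Def. 4.2.1] -/
def toPresentation (a : Fin c.r) : ProetAffinePresentation X (c.V a) where
  ι := c.K
  diagram := c.diagram a
  isAffine := c.isAffine a
  π := c.ρ a
  isLimit := c.isLimit a

/-- The covering family `(V_a → W)_a` as a pre-`0`-hypercover (index type `ULift (Fin r)` in
`Type (u+1)`, so that its Čech complexes with `Ab.{u+1}` coefficients are defined; reducible, so
that `c.family.I₀`, `c.family.X`, `c.family.f` unfold in rewriting). [folklore] -/
abbrev family : PreZeroHypercover.{uS + 1} W where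
  I₀ := ULift.{uS + 1} (Fin c.r)
  X a := c.V a.down
  f a := c.hom a.down

end PresentedCover

end PresentedCover

end Literature.AlgebraicGeometry.Motives

end
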